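import Mathlib
import HarnessLib
import Summits.NavierStokesRegularity.NavierStokesRegularity.Theorems.AxisTwistDoorSignConeDefs
import Summits.NavierStokesRegularity.NavierStokesRegularity.Theorems.AxisTwistDoorSignConeZoomFamily
import Summits.NavierStokesRegularity.NavierStokesRegularity.Theorems.AxisTwistDoorSignConeZoomSingular
import Summits.NavierStokesRegularity.NavierStokesRegularity.Theorems.PoloidalWindowDoorPoloidalWindowRigidityWindow

/-!
# AxisTwistDoor · crux `TiltDominationLoc` (stmt-NavierStokesRegularity-26991), line «signcone» — THE STUB
# `stub_saturatedElement : StubSaturatedElement` (PUSH step of ns-idea-6 g7's line), BY NAME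

`--supports stmt-NavierStokesRegularity-26991` (registered stub `stub_saturatedElement` of the LEAD's skeleton of record
`Lines/signcone.lean`, sha `fe46809609bb…`, ns-atd-p1 g4 2026-08-28T16:30:50Z; seat ns-imp-p1 g5, DIRECTOR-NS #244 (4)(ii)).

**SATURATED ELEMENT.**  If a backward-singular CORE profile (`IsCore`: Type-I rate, continuity on the open slab, unit-viscosity
Oseen identity, divergence-free slices) with one-signed vertical vorticity `ω₃ ≥ 0` exists, then a SIGN-SATURATED one exists:
every direction against which its vorticity is non-negative on SOME apex cylinder `(−ρ², 0) × B(0, ρ)` is non-negative on the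
whole backward slab (`IsSignSaturated`), and it is again core, one-signed and backward-singular at the apex.

Proof (all inputs are tree theorems).  The core profile `v` lies in the KNSS class `A_C` (`isTypeIAncientMild_of_class`).
`…SignConeZoomFamily.exists_saturated_zoomLimit` produces a pointwise limit `W ∈ A_C` of apex zooms `νₙ v(νₙ²·, νₙ·)`,
`νₙ → 0⁺`, whose sign cone contains that of `v` (so `e₃` stays one-signed) and which is sign-saturated (greedy stabilisation
of the closed sign cones over the family of apex-zoom limits of `v`, which is closed under zoom-in limits and under pointwise
limits by KNSS `C¹_loc` compactness); `…SignConeZoomSingular.isBackwardSingularPoint_of_zoomLimit` shows `W` is backward-singular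
(it is a.e. Seregin's ancient zoom-in limit of `v` along the same scales).  The class `A_C` hands back the four core clauses.

HONEST FRAMING: a normal-form / compactness statement about HYPOTHETICAL one-signed Type-I blow-up profiles — the cheap PUSH
step of the line, NOT its wall `StubRayRigidity` (= crux 26991 on the saturated ray-cone subclass, W3 of the NS wall board,
no seat) and NOT the new rung `StubDihedralRigidity`; `TiltDominationLoc`, the leaf `HalfSpaceWindowDoor.Target` and
Navier–Stokes regularity (Clay A) remain OPEN.  Author of the line: ns-idea-6 g7; LEAD of record: ns-atd-p1.
-/

noncomputable section

-- the summit and its single sub-problem share the name (CONVENTIONS §1), as in every Theorems file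
set_option linter.dupNamespace false

namespace Summit.NavierStokesRegularity.NavierStokesRegularity.Theorems.AxisTwistDoorSignConeSaturatedElement

open MeasureTheory Set Function Filter Topology
open scoped InnerProductSpace RealInnerProductSpace
open Literature.Analysis Literature.Analysis.FluidPDE
open Summit.NavierStokesRegularity.NavierStokesRegularity.Theorems
open Summit.NavierStokesRegularity.NavierStokesRegularity.Theorems.AxisTwistDoorSignConeDefs

/-- **Registered stub `stub_saturatedElement` of line «signcone» on crux 26991** (`StubSaturatedElement`, verbatim): if a
backward-singular core profile with `ω₃ ≥ 0` exists, a SIGN-SATURATED one exists (module docstring).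
[cite: KochNadirashviliSereginSverak2009, Lemma 6.1 and Prop. 4.1 (arXiv:0709.3599 pp. 8, 11)] [cite: Seregin2020, proof of Thm. 2.1] -/
theorem stub_saturatedElement : StubSaturatedElement := by
  rintro ⟨C, v, ⟨hrate, hcont, hmild, hdiv⟩, he3, hsing⟩
  have hv : IsTypeIAncientMild C v :=
    PoloidalWindowDoorPoloidalWindowRigidityWindow.isTypeIAncientMild_of_class hrate hcont hmild hdiv
  obtain ⟨W, hW, ⟨ν, hν, hν0, hcv⟩, hmono, hsat⟩ := AxisTwistDoorSignConeZoomFamily.exists_saturated_zoomLimit hv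
  refine ⟨C, W, ⟨hW.hasTypeITimeDecay, hW.continuousOn_uncurry, fun s t hst ht x => hW.mild_eq_heatExtension hst ht x,
    fun t ht => hW.isDivFree ht⟩, hmono _ he3, ?_, fun e he => hsat e he⟩
  exact AxisTwistDoorSignConeZoomSingular.isBackwardSingularPoint_of_zoomLimit hrate hcont hmild hdiv hsing hν hν0 hcv

/-- Alias in the tree's `<route>_<decl>` naming style: the signcone line's saturated-element stub on crux 26991
(`AxisTwistDoorSignConeDefs.StubSaturatedElement`). [folklore] -/
theorem axisTwistDoor_signCone_saturatedElement : StubSaturatedElement := stub_saturatedElement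

end Summit.NavierStokesRegularity.NavierStokesRegularity.Theorems.AxisTwistDoorSignConeSaturatedElement

end
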